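import Summits.MatrixMultiplication.OmegaCensus.STPPSmallPatternKernelReflect122

/-!
# ω-census, small STPP pattern `(1,2,2)^k`: reflection for the CHUNKED search `search2x`

HONEST FRAMING (pub-omega census; verbatim): lottery ticket; floor = certified bounds/negative ranges.
Census STRUCTURE bookkeeping of the STPP track (seat pub-omega-stpp-3, gen 23; STRUCTURE row B5, column `T2`), not progress on `ω`.

`STPP122Neg.search2x` (`STPPSmallPatternKernelSearch122.lean`) runs the representative `y` only over the first-level codes `c'₀`
outside an exclusion mask `x1`, so that one representative's subtree can be spread over several kernel evaluations.  This file
transfers the reflection theorem of `search2` (`STPPSmallPatternKernelReflect122.lean`) to the chunked form: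
`not_exists_isSTPP_122_of_search2x` — a `true` chunked search whose chunks cover, for every listed representative, all codes,
together with the covering maps, excludes every STPP family of size pattern `(1,2,2)^k` (CKSU Def. 5.1, tree `IsSTPP`).

References: H. Cohn, R. Kleinberg, B. Szegedy, C. Umans, FOCS 2005 (arXiv:math/0511460), Def. 5.1.
-/

namespace Summit.MatrixMultiplication.OmegaCensus

namespace STPP122Neg

open STPP211Neg Literature.Computability.AlgebraicComplexity

section Refl

variable {G : Type} [AddCommGroup G] {E : GEnc G} {K : ℕ} {b b' c c' : Fin K → G}

/-- THE CHUNKED START OF THE SOLUTION'S REPRESENTATIVE ANSWERS `false` when its exclusion mask misses the code of `c'₀`. -/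
theorem start2x_false (hM : ModelD2 b b' c c') (hNF : NF2 E b b' c c') (hK : 0 < K) (hb0 : b ⟨0, hK⟩ = 0)
    (hc0 : c ⟨0, hK⟩ = 0) {x1 : ℕ} (hx1 : x1.testBit (E.enc (c' ⟨0, hK⟩)) = false) :
    start2x E.g (E.enc (b' ⟨0, hK⟩)) x1 (below2 E.g (K - 1)) = false := by
  set i0 : Fin K := ⟨0, hK⟩
  unfold start2x
  rw [force_eq]
  have e0 : (0 : ℕ) = E.enc (b i0) := by rw [hb0, E.enc_zero]
  have e0' : (0 : ℕ) = E.enc (c i0) := by rw [hc0, E.enc_zero]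
  have hcf : (Nat.xor E.g.full (Nat.land (lowMask 1) E.g.full)).testBit (E.enc (c' i0)) = true := by
    rw [testBit_fullXor, testBit_lowMask_land]
    have := hNF.2.2 i0; rw [← e0'] at this
    simp; omega
  cases h : allBits (Nat.xor E.g.full (Nat.land (lowMask 1) E.g.full)) _ (Nat.xor E.g.full (Nat.land (lowMask 1) E.g.full))
  · rfl
  exfalso
  have h1 := allBits_spec _ _ _ le_rfl h _ hcf
  rw [hx1, Bool.false_or, e0] at h1
  conv at h1 => rw [show validNew E.g St2.empty (E.enc (b i0)) (E.enc (b' i0)) (E.enc (b i0)) (E.enc (c' i0)) =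
    validNew E.g St2.empty (E.enc (b i0)) (E.enc (b' i0)) (E.enc (c i0)) (E.enc (c' i0)) by rw [← e0, ← e0'],
    show child2 E.g St2.empty (E.enc (b i0)) (E.enc (b' i0)) (E.enc (b i0)) (E.enc (c' i0)) (below2 E.g (K - 1)) =
    child2 E.g St2.empty (E.enc (b i0)) (E.enc (b' i0)) (E.enc (c i0)) (E.enc (c' i0)) (below2 E.g (K - 1)) by rw [← e0, ← e0']]
  rw [validNew_true hM (invM2_empty E b b' c c') i0 rfl, child2_eq] at h1
  have hS1 := invM2_childSt2 (E := E) (b := b) (b' := b') (c := c) (c' := c') i0 rfl (invM2_empty E b b' c c')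
  have hbelow : below2 E.g (K - 1) (childSt2 E.g St2.empty (E.enc (b i0)) (E.enc (b' i0)) (E.enc (c i0)) (E.enc (c' i0))) =
      false := by
    rcases Nat.eq_zero_or_pos (K - 1) with hK1 | hK1
    · rw [hK1]; rfl
    · obtain ⟨r, hr⟩ : ∃ r, K - 1 = r + 1 := ⟨K - 1 - 1, by omega⟩
      rw [hr]
      exact below2_false hM hNF (r + 1) 1 i0 _ (by omega) rfl hS1 rfl
  rw [hbelow] at h1
  exact Bool.false_ne_true h1

/-- A `true` chunked search refutes every listed chunk. -/
theorem start2x_of_search2x {g : GC} {k : ℕ} : ∀ {R : List (ℕ × ℕ)}, search2x g k R = true → ∀ e ∈ R,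
    start2x g e.1 e.2 (below2 g (k - 1)) = true := by
  intro R
  induction R with
  | nil => intro _ e he; simp at he
  | cons e' R ih =>
      intro h e he
      rw [search2x_cons, Bool.and_eq_true] at h
      rcases List.mem_cons.1 he with rfl | he
      · exact h.1
      · exact ih h.2 e he

/-- **REFLECTION (difference model), chunked search.** -/
theorem not_modelD2_of_search2x (E : GEnc G) (hK : 0 < K) {chunks : List (ℕ × ℕ)} (hsearch : search2x E.g K chunks = true)
    {reps : List ℕ} (hchunks : ∀ y ∈ reps, ∀ z, z < E.g.n → ∃ e ∈ chunks, e.1 = y ∧ e.2.testBit z = false)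
    {auts : List (G →+ G)} (hinj : ∀ f ∈ auts, Function.Injective f)
    (hcover : ∀ d : G, d ≠ 0 → ∃ f ∈ auts, E.enc (f d) ∈ reps) (b b' c c' : Fin K → G) : ¬ ModelD2 b b' c c' := by
  intro hM
  obtain ⟨p, p', q, q', hM', hNF, hp0, hq0, hd⟩ := exists_normalForm2 E hM hK hinj hcover
  obtain ⟨e, he, h1, h2⟩ := hchunks _ hd (E.enc (q' ⟨0, hK⟩)) (E.enc_lt _)
  have := start2x_of_search2x hsearch e he
  obtain ⟨y, x1⟩ := e
  simp only at h1 h2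
  subst h1
  rw [start2x_false hM' hNF hK hp0 hq0 h2] at this
  exact Bool.false_ne_true this

/-- **REFLECTION THROUGH DEF. 5.1, chunked search** (pattern `(1,2,2)^k`): a `true` `search2x` whose chunks cover all codes of every
listed representative, plus the covering maps, excludes every STPP family (CKSU Def. 5.1, tree `IsSTPP`) of `K` triples with
`|Aᵢ| = 1`, `|Bᵢ| = |Cᵢ| = 2`. [cite: CohnKleinbergSzegedyUmans2005, Def. 5.1] -/
theorem not_exists_isSTPP_122_of_search2x [DecidableEq G] (E : GEnc G) (hK : 0 < K) {chunks : List (ℕ × ℕ)}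
    (hsearch : search2x E.g K chunks = true) {reps : List ℕ}
    (hchunks : ∀ y ∈ reps, ∀ z, z < E.g.n → ∃ e ∈ chunks, e.1 = y ∧ e.2.testBit z = false)
    {auts : List (G →+ G)} (hinj : ∀ f ∈ auts, Function.Injective f)
    (hcover : ∀ d : G, d ≠ 0 → ∃ f ∈ auts, E.enc (f d) ∈ reps) :
    ¬ ∃ A B C : Fin K → Finset G, IsSTPP A B C ∧ ∀ i, (A i).card = 1 ∧ (B i).card = 2 ∧ (C i).card = 2 := by
  rw [exists_isSTPP_122_iff]
  rintro ⟨p, p', q, q', hb, hc, hU, hX⟩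
  exact not_modelD2_of_search2x E hK hsearch hchunks hinj hcover p p' q q' (modelD2_of_finsetForm hb hc hU hX)

end Refl

end STPP122Neg

end Summit.MatrixMultiplication.OmegaCensus
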